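import Summits.Ventures.PercRepro.RankLevelSetPerElemThreeCount

/-! # RankLevelSetPerElemThreeDual — THE DUAL PICTURE OF BI-INDEPENDENCE, THE THROUGH-QUADRUPLE OF EVERY
ABSORBING `3`-SET, AND THE PAIR-COUNTING LEMMA (night-1 g36; dossier §48; on `RankLevelSetPerElemThreeCount`)

A subset `X` of the ground set is independent iff its complement spans the dual `M✶` (`dual_coindep_iff`,
`coindep_iff_compl_spanning`), so a set is BI-INDEPENDENT iff it and its complement BOTH SPAN THE DUAL
(`mem_biIndep_iff_dual`). For an absorbing `3`-set `Z` avoiding `y` (`Z ∈ D_3`, `y ∉ Z`, `insert y Z` dependent) and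
`J := E ∖ (Z ∪ {y})`, this says: `insert y J = E ∖ Z` spans `M✶`, `J` does not (its complement `insert y Z` is
dependent), so `y ∉ cl✶ J`; and `Z` spans `M✶`, so `M✶` has rank `≤ 3` and `J` has dual rank `≤ 2`. Hence
(**`exists_through_quadruple`**, the hypothesis `hA` of `perElemAt_three_of_exists`, with NO hypothesis on the
matroid): a dual basis of `J` extended to a `3`-subset `T ⊆ J` has `cl✶ T = cl✶ J ∌ y`, so `insert y T` spans
`M✶`, its complement contains `Z` and spans too, and `insert y T ∈ D_4`. The module ends with the pure counting
lemma of the three good pairs (`three_le_ncard_pairs`): on a finite set `J` with `4 ≤ #J`, if two predicates `P`,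
`R` cover `J` and each holds somewhere, at least three `2`-subsets of `J` contain a `P`-element and leave an
`R`-element outside — used in `RankLevelSetPerElemThreeGood` for the triangle members. Every declaration has a
docstring; imports: the cell's own modules and Mathlib only. Axioms: standard. -/

namespace PercRepro

open Set Matroid

variable {α : Type} (M : Matroid α) [M.Finite]

/-! ## Bi-independence in the dual -/

omit [M.Finite] in
/-- A subset of the ground set is independent iff its complement spans the dual. -/
lemma indep_iff_dual_spanning_compl {X : Set α} (hX : X ⊆ M.E) :
    M.Indep X ↔ M✶.Spanning (M.E \ X) := by
  rw [← Matroid.dual_coindep_iff, Matroid.coindep_iff_compl_spanning (by rwa [Matroid.dual_ground]),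
    Matroid.dual_ground]

omit [M.Finite] in
/-- The complement of a subset of the ground set is independent iff the subset spans the dual. -/
lemma indep_compl_iff_dual_spanning {X : Set α} (hX : X ⊆ M.E) :
    M.Indep (M.E \ X) ↔ M✶.Spanning X := by
  rw [indep_iff_dual_spanning_compl M Set.sdiff_subset, Set.sdiff_sdiff_cancel_left hX]

omit [M.Finite] in
/-- **A set is bi-independent iff it and its complement both span the dual.** -/
lemma mem_biIndep_iff_dual {k : ℕ} {Q : Set α} :
    Q ∈ biIndep M k ↔ Q ⊆ M.E ∧ Q.ncard = k ∧ M✶.Spanning (M.E \ Q) ∧ M✶.Spanning Q := by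
  constructor
  · rintro ⟨hQE, hQk, hQi, hci⟩
    exact ⟨hQE, hQk, (indep_iff_dual_spanning_compl M hQE).mp hQi,
      (indep_compl_iff_dual_spanning M hQE).mp hci⟩
  · rintro ⟨hQE, hQk, hs1, hs2⟩
    exact ⟨hQE, hQk, (indep_iff_dual_spanning_compl M hQE).mpr hs1,
      (indep_compl_iff_dual_spanning M hQE).mpr hs2⟩

/-- If `insert e X` spans and `X` does not, then `e` is not in the closure of `X` (any matroid `N`). -/
lemma notMem_closure_of_spanning_insert {N : Matroid α} {X : Set α} {e : α}
    (hs : N.Spanning (insert e X)) (hns : ¬ N.Spanning X) : e ∉ N.closure X := by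
  intro he
  apply hns
  refine ⟨?_, (Set.subset_insert e X).trans hs.subset_ground⟩
  rw [← Matroid.closure_insert_eq_of_mem_closure he]
  exact hs.closure_eq

/-- If `e ∈ N.E` is not in the closure of `X` and `insert e X` spans `N`, then `eRk X + 1 = eRank`
(any matroid `N`). -/
lemma eRk_add_one_eq_eRank_of_spanning_insert {N : Matroid α} {X : Set α} {e : α}
    (heE : e ∈ N.E) (he : e ∉ N.closure X) (hs : N.Spanning (insert e X)) :
    N.eRk X + 1 = N.eRank := by
  rw [← Matroid.eRk_insert_eq_add_one ⟨heE, he⟩, ← hs.eRk_eq]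

/-! ## The dual facts of an absorbing `3`-set -/

/-- For an absorbing `3`-set `Z` avoiding `y` and `J := E ∖ insert y Z`: `insert y J = E ∖ Z` spans `M✶`,
`J` does not, `y ∉ cl✶ J`, `Z` spans `M✶`, and `M✶` has rank at most `3`. -/
lemma absorb_three_dual_facts {y : α} (hy : y ∈ M.E) {Z : Set α} (hZ : Z ∈ lowAbsorbAt M y 3) :
    M.E \ Z = insert y (M.E \ insert y Z) ∧ M✶.Spanning (insert y (M.E \ insert y Z)) ∧
      ¬ M✶.Spanning (M.E \ insert y Z) ∧ y ∉ M✶.closure (M.E \ insert y Z) ∧ M✶.Spanning Z ∧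
      M✶.eRank ≤ 3 := by
  obtain ⟨⟨hZE, hZ3, hZi, hcind⟩, hyZ, hdep⟩ := hZ
  have hyZE : insert y Z ⊆ M.E := Set.insert_subset hy hZE
  have hZfin : Z.Finite := M.ground_finite.subset hZE
  have hIeq : M.E \ Z = insert y (M.E \ insert y Z) := by
    ext x
    simp only [Set.mem_sdiff, Set.mem_insert_iff, not_or]
    constructor
    · rintro ⟨hxE, hxZ⟩
      by_cases hxy : x = y
      · exact Or.inl hxy
      · exact Or.inr ⟨hxE, hxy, hxZ⟩
    · rintro (rfl | ⟨hxE, -, hxZ⟩)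
      · exact ⟨hy, hyZ⟩
      · exact ⟨hxE, hxZ⟩
  have hIs : M✶.Spanning (insert y (M.E \ insert y Z)) := by
    rw [← hIeq]; exact (indep_iff_dual_spanning_compl M hZE).mp hZi
  have hZs : M✶.Spanning Z := (indep_compl_iff_dual_spanning M hZE).mp hcind
  have hJns : ¬ M✶.Spanning (M.E \ insert y Z) :=
    fun h => hdep ((indep_iff_dual_spanning_compl M hyZE).mpr h)
  have hrank : M✶.eRank ≤ 3 := by
    have h1 := (Matroid.spanning_iff_eRk_le (by rwa [Matroid.dual_ground])).mp hZs
    have h2 : M✶.eRk Z ≤ 3 := by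
      calc M✶.eRk Z ≤ Z.encard := M✶.eRk_le_encard Z
        _ = 3 := by rw [← hZfin.cast_ncard_eq, hZ3]; rfl
    exact h1.trans h2
  exact ⟨hIeq, hIs, hJns, notMem_closure_of_spanning_insert hIs hJns, hZs, hrank⟩

/-- The cardinality of `J = E ∖ insert y Z` for a `3`-set `Z ⊆ E` avoiding `y ∈ E`: `#E − 4`. -/
lemma ncard_compl_insert_three {y : α} (hy : y ∈ M.E) {Z : Set α} (hZE : Z ⊆ M.E) (hZ3 : Z.ncard = 3)
    (hyZ : y ∉ Z) : (M.E \ insert y Z).ncard = M.E.ncard - 4 := by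
  have hyZE : insert y Z ⊆ M.E := Set.insert_subset hy hZE
  have hZfin : Z.Finite := M.ground_finite.subset hZE
  rw [Set.ncard_sdiff hyZE (M.ground_finite.subset hyZE), Set.ncard_insert_of_notMem hyZ hZfin, hZ3]

/-! ## The through-quadruple of every absorbing `3`-set -/

/-- **EVERY ABSORBING `3`-SET HAS A THROUGH-`y` QUADRUPLE** (the hypothesis `hA` of `perElemAt_three_of_exists`, for
EVERY finite matroid with `7 ≤ #E`, no circuit-size hypothesis): for `y ∈ E` and `Z ∈ D_3` with `y ∉ Z` and
`insert y Z` dependent, there is `T ⊆ E ∖ insert y Z` with `#T = 3` and `insert y T ∈ D_4`. PROOF in the dual: a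
basis `B` of `J := E ∖ insert y Z` in `M✶` has `#B = rk✶ J ≤ rk✶ M✶ − 1 ≤ 2` (`y ∉ cl✶ J`, `insert y J` spans,
`Z` spans so `M✶` has rank `≤ 3`); extend `B` to a `3`-subset `T` of `J` (`#J = #E − 4 ≥ 3`); then
`cl✶ T = cl✶ J`, so `cl✶ (insert y T) = cl✶ (insert y J) = E` — `insert y T` spans `M✶` — and its complement
contains `Z`, which spans `M✶`; both halves span the dual, so `insert y T` is bi-independent. -/
theorem exists_through_quadruple {y : α} (hy : y ∈ M.E) (hn : 7 ≤ M.E.ncard) {Z : Set α}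
    (hZ : Z ∈ lowAbsorbAt M y 3) :
    ∃ T, T ⊆ M.E \ insert y Z ∧ T.ncard = 3 ∧ insert y T ∈ biIndep M 4 := by
  obtain ⟨hIeq, hIs, hJns, hyJ, hZs, hrank⟩ := absorb_three_dual_facts M hy hZ
  obtain ⟨⟨hZE, hZ3, -, -⟩, hyZ, -⟩ := hZ
  have hJE : M.E \ insert y Z ⊆ M.E := Set.sdiff_subset
  have hJfin : (M.E \ insert y Z).Finite := M.ground_finite.subset hJE
  have hJcard := ncard_compl_insert_three M hy hZE hZ3 hyZ
  have hyE' : y ∈ M✶.E := by rwa [Matroid.dual_ground]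
  have hJE' : M.E \ insert y Z ⊆ M✶.E := by rwa [Matroid.dual_ground]
  -- a dual basis of `J` has at most two elements
  obtain ⟨B, hB⟩ := M✶.exists_isBasis (M.E \ insert y Z) hJE'
  have hBJ : B ⊆ M.E \ insert y Z := hB.subset
  have hBfin : B.Finite := hJfin.subset hBJ
  have hB2 : B.ncard ≤ 2 := by
    have h1 := eRk_add_one_eq_eRank_of_spanning_insert hyE' hyJ hIs
    have h3 : M✶.eRk (M.E \ insert y Z) = B.encard := hB.eRk_eq_encard
    have h4 : ((B.ncard + 1 : ℕ) : ℕ∞) ≤ ((3 : ℕ) : ℕ∞) := by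
      push_cast
      rw [hBfin.cast_ncard_eq, ← h3, h1]
      exact hrank
    have h5 : B.ncard + 1 ≤ 3 := by exact_mod_cast h4
    omega
  -- extend it to a `3`-subset of `J`
  obtain ⟨T, hBT, hTJ, hT3⟩ :=
    Set.exists_subsuperset_card_eq hBJ (by omega : B.ncard ≤ 3) (by rw [hJcard]; omega)
  refine ⟨T, hTJ, hT3, ?_⟩
  have hclT : M✶.closure T = M✶.closure (M.E \ insert y Z) := by
    refine subset_antisymm (M✶.closure_subset_closure hTJ) ?_
    rw [← hB.closure_eq_closure]
    exact M✶.closure_subset_closure hBT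
  have hyT : y ∉ T := fun h => (hTJ h).2 (Set.mem_insert y Z)
  have hTfin : T.Finite := hJfin.subset hTJ
  have hTE : T ⊆ M.E := hTJ.trans hJE
  rw [mem_biIndep_iff_dual]
  refine ⟨Set.insert_subset hy hTE, ?_, ?_, ?_⟩
  · rw [Set.ncard_insert_of_notMem hyT hTfin, hT3]
  · -- the complement contains `Z`, which spans the dual
    refine hZs.superset ?_ (by rw [Matroid.dual_ground]; exact Set.sdiff_subset)
    intro x hx
    refine ⟨hZE hx, ?_⟩
    simp only [Set.mem_insert_iff, not_or]
    exact ⟨fun hxy => hyZ (hxy ▸ hx), fun hxT => (hTJ hxT).2 (Set.mem_insert_of_mem y hx)⟩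
  · -- `insert y T` spans the dual: `cl✶ (insert y T) = cl✶ (insert y J) = E`
    refine ⟨?_, by rw [Matroid.dual_ground]; exact Set.insert_subset hy hTE⟩
    rw [← Matroid.closure_insert_closure_eq_closure_insert, hclT,
      Matroid.closure_insert_closure_eq_closure_insert]
    exact hIs.closure_eq

/-! ## The pair-counting lemma -/

omit [M.Finite] in
/-- Two pairs with different first or second coordinates in both matchings are different. -/
lemma pair_ne_pair_of {a b c d : α} (h1 : a ≠ c ∨ b ≠ d) (h2 : a ≠ d ∨ b ≠ c) :
    ({a, b} : Set α) ≠ {c, d} := by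
  rw [Ne, Set.pair_eq_pair_iff]
  rintro (⟨rfl, rfl⟩ | ⟨rfl, rfl⟩)
  · rcases h1 with h | h <;> exact h rfl
  · rcases h2 with h | h <;> exact h rfl

omit [M.Finite] in
/-- A pair `{a, b} ⊆ J` with `a ≠ b`, `P a`, and an `R`-element `u ∈ J` off the pair, is a good pair. -/
lemma pair_mem_good {J : Set α} {P R : α → Prop} {a b u : α} (ha : a ∈ J) (hb : b ∈ J) (hab : a ≠ b)
    (hPa : P a) (hu : u ∈ J) (hua : u ≠ a) (hub : u ≠ b) (hRu : R u) :
    ({a, b} : Set α) ∈ {T | T ⊆ J ∧ T.ncard = 2 ∧ (∃ t ∈ T, P t) ∧ (∃ u ∈ J \ T, R u)} := by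
  refine ⟨?_, Set.ncard_pair hab, ⟨a, Set.mem_insert a _, hPa⟩, ⟨u, ⟨hu, ?_⟩, hRu⟩⟩
  · rintro x (rfl | rfl)
    · exact ha
    · exact hb
  · simp only [Set.mem_insert_iff, Set.mem_singleton_iff, not_or]
    exact ⟨hua, hub⟩

omit [M.Finite] in
/-- **THE PAIR-COUNTING LEMMA**: on a finite set `J` with `4 ≤ #J`, for predicates `P`, `R` with `P ∨ R`
everywhere on `J`, each holding somewhere on `J`, at least three `2`-subsets `T` of `J` contain a `P`-element and
leave an `R`-element outside. PROOF by the number `ρ ≥ 1` of `R`-elements: `ρ ≥ 3` — the pairs `{t, x}` for a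
`P`-element `t` and three `x ≠ t`; `ρ = 2` (`R`-set `{u, v}`) — `{u, b₁}`, `{u, b₂}`, `{v, b₁}` for two non-`R`
(hence `P`) elements `b₁ ≠ b₂`; `ρ = 1` (`R`-set `{u}`) — three pairs among three non-`R` elements. -/
lemma three_le_ncard_pairs {J : Set α} (hJfin : J.Finite) (hJ4 : 4 ≤ J.ncard) (P R : α → Prop)
    (hPR : ∀ t ∈ J, P t ∨ R t) (hP : ∃ t ∈ J, P t) (hR : ∃ u ∈ J, R u) :
    3 ≤ {T | T ⊆ J ∧ T.ncard = 2 ∧ (∃ t ∈ T, P t) ∧ (∃ u ∈ J \ T, R u)}.ncard := by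
  set G := {T | T ⊆ J ∧ T.ncard = 2 ∧ (∃ t ∈ T, P t) ∧ (∃ u ∈ J \ T, R u)} with hG
  have hGfin : G.Finite := hJfin.finite_subsets.subset (fun T hT => hT.1)
  set U := {u ∈ J | R u} with hU
  have hUJ : U ⊆ J := fun u hu => hu.1
  have hUfin : U.Finite := hJfin.subset hUJ
  have hVP : ∀ b ∈ J \ U, P b := by
    rintro b ⟨hbJ, hbU⟩
    rcases hPR b hbJ with h | h
    · exact h
    · exact absurd ⟨hbJ, h⟩ hbU
  have hVcard : (J \ U).ncard = J.ncard - U.ncard := Set.ncard_sdiff hUJ hUfin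
  suffices h : 2 < G.ncard by omega
  rw [Set.two_lt_ncard_iff hGfin]
  rcases Nat.lt_or_ge U.ncard 3 with hU3 | hU3
  · rcases Nat.lt_or_ge U.ncard 2 with hU2 | hU2
    · -- `ρ ≤ 1`: in fact `ρ = 1`
      obtain ⟨u, huJ, hRu⟩ := hR
      have huU : u ∈ U := ⟨huJ, hRu⟩
      have hU1 : U.ncard = 1 := by
        have : 0 < U.ncard := (Set.ncard_pos hUfin).mpr ⟨u, huU⟩
        omega
      obtain ⟨u', hUeq⟩ := Set.ncard_eq_one.mp hU1
      have huu' : u = u' := by rw [hUeq] at huU; exact huU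
      subst huu'
      have hV3 : 2 < (J \ U).ncard := by omega
      obtain ⟨b₁, b₂, b₃, hb₁, hb₂, hb₃, h12, h13, h23⟩ :=
        (Set.two_lt_ncard_iff (hJfin.subset Set.sdiff_subset)).mp hV3
      have hub : ∀ b ∈ J \ U, u ≠ b := fun b hb h => hb.2 (h ▸ huU)
      refine ⟨{b₁, b₂}, {b₁, b₃}, {b₂, b₃}, pair_mem_good hb₁.1 hb₂.1 h12 (hVP b₁ hb₁) huJ (hub b₁ hb₁)
        (hub b₂ hb₂) hRu, pair_mem_good hb₁.1 hb₃.1 h13 (hVP b₁ hb₁) huJ (hub b₁ hb₁) (hub b₃ hb₃) hRu,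
        pair_mem_good hb₂.1 hb₃.1 h23 (hVP b₂ hb₂) huJ (hub b₂ hb₂) (hub b₃ hb₃) hRu, ?_, ?_, ?_⟩
      · exact pair_ne_pair_of (Or.inr h23) (Or.inl h13)
      · exact pair_ne_pair_of (Or.inl h12) (Or.inl h13)
      · exact pair_ne_pair_of (Or.inl h12) (Or.inl h13)
    · -- `ρ = 2`
      have hU2' : U.ncard = 2 := by omega
      obtain ⟨u, v, huv, hUeq⟩ := Set.ncard_eq_two.mp hU2'
      have huU : u ∈ U := by rw [hUeq]; exact Set.mem_insert u _
      have hvU : v ∈ U := by rw [hUeq]; exact Set.mem_insert_of_mem u rfl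
      have hV2 : 1 < (J \ U).ncard := by omega
      obtain ⟨b₁, b₂, hb₁, hb₂, h12⟩ := (Set.one_lt_ncard_iff (hJfin.subset Set.sdiff_subset)).mp hV2
      have hub : ∀ b ∈ J \ U, u ≠ b := fun b hb h => hb.2 (h ▸ huU)
      have hvb : ∀ b ∈ J \ U, v ≠ b := fun b hb h => hb.2 (h ▸ hvU)
      refine ⟨{b₁, u}, {b₂, u}, {b₁, v}, pair_mem_good hb₁.1 huU.1 (hub b₁ hb₁).symm (hVP b₁ hb₁) hvU.1
        (hvb b₁ hb₁) huv.symm hvU.2, pair_mem_good hb₂.1 huU.1 (hub b₂ hb₂).symm (hVP b₂ hb₂) hvU.1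
        (hvb b₂ hb₂) huv.symm hvU.2, pair_mem_good hb₁.1 hvU.1 (hvb b₁ hb₁).symm (hVP b₁ hb₁) huU.1
        (hub b₁ hb₁) huv huU.2, ?_, ?_, ?_⟩
      · exact pair_ne_pair_of (Or.inl h12) (Or.inl (hub b₁ hb₁).symm)
      · exact pair_ne_pair_of (Or.inr huv) (Or.inl (hvb b₁ hb₁).symm)
      · exact pair_ne_pair_of (Or.inl h12.symm) (Or.inl (hvb b₂ hb₂).symm)
  · -- `ρ ≥ 3`
    obtain ⟨t, htJ, hPt⟩ := hP
    have h3 : 2 < (J \ {t}).ncard := by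
      rw [Set.ncard_sdiff_singleton_of_mem htJ]; omega
    obtain ⟨a, b, c, ha, hb, hc, hab, hac, hbc⟩ :=
      (Set.two_lt_ncard_iff (hJfin.subset Set.sdiff_subset)).mp h3
    have hgood : ∀ x ∈ J \ {t}, ({t, x} : Set α) ∈ G := by
      intro x hx
      have hxt : t ≠ x := fun h => hx.2 (by rw [Set.mem_singleton_iff]; exact h.symm)
      -- an `R`-element outside `{t, x}`
      have hne : (U \ {t, x}).Nonempty := by
        rw [← Set.ncard_pos (hUfin.subset Set.sdiff_subset)]
        have := Set.le_ncard_sdiff ({t, x} : Set α) U (Set.toFinite _)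
        rw [Set.ncard_pair hxt] at this
        omega
      obtain ⟨u, huU, hu⟩ := hne
      simp only [Set.mem_insert_iff, Set.mem_singleton_iff, not_or] at hu
      exact pair_mem_good htJ hx.1 hxt hPt huU.1 hu.1 hu.2 huU.2
    refine ⟨{t, a}, {t, b}, {t, c}, hgood a ha, hgood b hb, hgood c hc, ?_, ?_, ?_⟩
    · exact pair_ne_pair_of (Or.inr hab) (Or.inr (fun h => ha.2 (by rw [Set.mem_singleton_iff]; exact h)))
    · exact pair_ne_pair_of (Or.inr hac) (Or.inr (fun h => ha.2 (by rw [Set.mem_singleton_iff]; exact h)))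
    · exact pair_ne_pair_of (Or.inr hbc) (Or.inr (fun h => hb.2 (by rw [Set.mem_singleton_iff]; exact h)))

end PercRepro
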